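import Literature.NumberTheory.EllipticCurves.ModularCurveManinSemistableLatticeFormProofs
import Literature.NumberTheory.EllipticCurves.SzpiroLocalDataProofs
import Literature.NumberTheory.EllipticCurves.DegreeConjectureAbcPrelims
import Literature.NumberTheory.DiophantineGeometry.LocalReductionIsSemistableAtProofs
import HarnessLib

/-!
# `abs_maninConstant_eq_one_of_isSemistable`: the coprime-invariants ("minimal `f`-model") form
# of its open content

Topic `NumberTheory/EllipticCurves`; a proofs-only companion (theorems only: no definition, no
named fact, nothing restated; D-0026) of `ModularCurveManinSemistableLatticeFormProofs.lean`,
written by the seat of the named fact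
`ModularParametrizationData.abs_maninConstant_eq_one_of_isSemistable` (`ModularCurve.lean`;
Česnavičius 2018, Thm. 1.2: the Manin constant `c_π` of a new elliptic optimal quotient
`π : J₀(n) ↠ E` has `ord_p(c_π) = 0` for every prime `p` with `p² ∤ n`, so `c = ±1` for
semistable `E`).

The earlier companions reduced the universal closure of that fact, with no hypothesis, to
statements about a globally minimal model `W` of a semistable `E/ℚ`, its newform `f`, a period
pair `L_f` spanning `Λ_f`, a Néron-type period pair `L` of `W` and an integer `c` with
`Λ_L = c Λ_f` (the Manin constant of the strong Weil curve relative to the Néron differential):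
`|c| = 1` (lattice form), `c₄(W) = 12 g₂(Λ_f) ∧ c₆(W) = 216 g₃(Λ_f)` (invariant form),
`Δ(W) = Δ(Λ_f)` (discriminant form). All of these still *conclude* something about `W`. This
file removes `W` from the conclusion: in that situation the lattice invariants
`c₄(Λ_f) := 12 g₂(Λ_f)`, `c₆(Λ_f) := 216 g₃(Λ_f)` and `Δ(Λ_f) := g₂(Λ_f)³ − 27 g₃(Λ_f)²` are the
*integers* `c⁴ c₄(W_ℤ)`, `c⁶ c₆(W_ℤ)`, `c¹² Δ(W_ℤ)` (`W_ℤ = integralModelInt W`, the integral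
global minimal model) — they are the invariants of the integral model `W_f := (1/c) • W_ℤ` of `E`
whose invariant differential pulls back to `2πi f(τ) dτ` on the nose — and

* **`|c| = 1` iff `c₄(Λ_f)` and `Δ(Λ_f)` are coprime** (`abs_eq_one_iff_isCoprime_of_isSemistable`,
  `IsNeronLatticeOf.abs_eq_one_iff_forall_intCast_isCoprime`), i.e. iff the `f`-model `W_f`
  (discriminant `c¹² Δ_min`) is itself a global minimal model; prime by prime, **`p ∤ c` iff
  `p ∤ gcd(c₄(Λ_f), Δ(Λ_f))`**, which needs `E` semistable *at `p`* only
  (`not_dvd_iff_of_isSemistableAt`, `IsNeronLatticeOf.not_dvd_iff_forall_intCast`) — the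
  dictionary for Česnavičius's prime-by-prime statement `ord_p(c_π) = 0` for `p² ∤ n`;
* `ModularParametrizationData.forall_abs_maninConstant_eq_one_of_isSemistable_iff_coprimeForm` —
  the universal closure of the fact is equivalent to: *in the situation above, any integers
  `m = 12 g₂(Λ_f)` and `d = g₂(Λ_f)³ − 27 g₃(Λ_f)²` are coprime* — a property of the period
  lattice `Λ_f` of the newform alone, the form in which the conjecture is actually verified
  (Cremona 1997, §2.14, pp. 33–34: compute `c₄ = 12 g₂`, `c₆ = 216 g₃` from the periods of `f` and
  check that those integers "are the invariants of a global minimal model"; a global minimal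
  model of an elliptic curve over `ℚ` has semistable reduction everywhere iff `gcd(c₄, Δ) = 1`,
  Silverman AEC VII.5.1);
* `ModularParametrizationData.lattice_invariants_eq_of_modularDegree_le` — for a datum of
  minimal degree (the hypothesis of the fact) and any `L_f` spanning `Λ_f`:
  `12 g₂(Λ_f) = c⁴ c₄(W_ℤ)`, `216 g₃(Λ_f) = c⁶ c₆(W_ℤ)`, `Δ(Λ_f) = c¹² Δ(W_ℤ)`;
* `ModularParametrizationData.abs_maninConstant_eq_one_iff_isCoprime`,
  `ModularParametrizationData.abs_maninConstant_eq_one_of_isSemistable_iff_isCoprime` — datum by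
  datum, for a globally minimal model `W` of a semistable curve and *any* datum `D`:
  `|c| = 1 ↔ IsCoprime (c⁴ c₄(W_ℤ)) (c¹² Δ(W_ℤ))`, and the fact for `D` is equivalent to the same
  implication with this coprimality as its conclusion.

The arithmetic input is the semistability criterion, proved here for the tree's notions
(`WeierstrassCurve.IsSemistable ℤ`, `WeierstrassCurve.IsGloballyMinimal`,
`WeierstrassCurve.integralModelInt`) and of independent use:

* `WeierstrassCurve.IsGloballyMinimal.isMinimalAt_int` — a globally minimal `W/ℚ` (minimal at the
  places of `𝓞 ℚ`) is minimal at every place of `ℤ` (transport through `ℚ_p`,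
  `isMinimalAt_iff_of_primesEquiv_eq`);
* `WeierstrassCurve.not_dvd_Δ_or_not_dvd_c₄_of_isSemistableAt`,
  `WeierstrassCurve.isSemistableAt_of_not_dvd_Δ_or_not_dvd_c₄`,
  `WeierstrassCurve.isSemistable_iff_isCoprime_c₄_Δ` — **for a global minimal model `W_ℤ` of an
  elliptic curve over `ℚ`: semistable at `p` iff `p ∤ Δ(W_ℤ)` or `p ∤ c₄(W_ℤ)`; semistable iff
  `gcd(c₄(W_ℤ), Δ(W_ℤ)) = 1`** (Silverman AEC VII.5, Prop. 5.1: for a minimal equation the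
  reduction is good iff `v(Δ) = 0`, multiplicative iff `v(Δ) > 0 = v(c₄)`, additive iff
  `v(Δ), v(c₄) > 0`; the tree's `isSemistableAt_iff_of_isMinimalAt`).

Nothing is discharged: the coprimality of `c₄(Λ_f)` and `Δ(Λ_f)` for the newform of a semistable
curve is Česnavičius's theorem (Néron models of `J₀(n)` and `E` over `ℤ_(p)`, Deligne–Rapoport,
Grothendieck duality, multiplicity one; 2018, §2), not available at the Mathlib pin. No statement
of the tree is changed.

## References

* K. Česnavičius, *The Manin constant in the semistable case*, Compositio Math. 154 (2018),
  1889–1920: Thm. 1.2 and §2. [Cesnavicius2018]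
* J. E. Cremona, *Algorithms for modular elliptic curves*, 2nd ed., CUP 1997: §2.14 (pp. 33–34),
  (2.14.1). [CremonaAlgorithms1997]
* J. H. Silverman, *The arithmetic of elliptic curves*, 2nd ed. (2009): VII.1 Remark 1.1,
  VII.5 Prop. 5.1 (PDF p. 174), VIII.8. [SilvermanAEC2009]
* B. Edixhoven, *On the Manin constants of modular elliptic curves* (1991): Prop. 2 (`c ∈ ℤ`).
  [EdixhovenManin1991]
-/

noncomputable section

open scoped MatrixGroups ModularForm

open IsDedekindDomain Rat.HeightOneSpectrum

/-! ### The semistability criterion `gcd(c₄, Δ_min) = 1` over `ℚ` -/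

namespace WeierstrassCurve

/-- **A globally minimal equation over `ℚ` is minimal at every place of `ℤ`.** The tree's
`IsGloballyMinimal` is indexed by the places of `𝓞 ℚ`, the tree's `IsSemistable ℤ` by the places
of `ℤ`; both minimality conditions are minimality of `W ⊗ ℚ_p` over `ℤ_p` for the prime `p` below
the place (`Literature.NumberTheory.EllipticCurves.isMinimalAt_iff_of_primesEquiv_eq`). Silverman,
AEC VIII.8 (definition of a global minimal equation). [folklore] -/
theorem IsGloballyMinimal.isMinimalAt_int (W : WeierstrassCurve ℚ) [hW : W.IsGloballyMinimal]
    (v : HeightOneSpectrum ℤ) : W.IsMinimalAt v := by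
  set v' : HeightOneSpectrum (NumberField.RingOfIntegers ℚ) :=
    (primesEquiv (R := NumberField.RingOfIntegers ℚ)).symm (primesEquiv v) with hv'
  have h : ((primesEquiv v : Nat.Primes) : ℕ) = primesEquiv v' := by
    rw [hv', Equiv.apply_symm_apply]
  exact (Literature.NumberTheory.EllipticCurves.isMinimalAt_iff_of_primesEquiv_eq v v' W h).mpr
    (hW.isMinimal v')

/-- The integral global minimal model base-changes back to `W`: `W_ℤ ⊗ ℚ = W`
(`map_integralModelInt`). [folklore] -/
theorem baseChange_integralModelInt (W : WeierstrassCurve ℚ) [W.IsGloballyMinimal] :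
    (integralModelInt W).baseChange ℚ = W := by
  rw [baseChange, algebraMap_int_eq]
  exact map_integralModelInt W

/-- `c₄(W) = c₄(W_ℤ)` in `ℚ`. [folklore] -/
theorem cast_integralModelInt_c₄ (W : WeierstrassCurve ℚ) [W.IsGloballyMinimal] :
    ((integralModelInt W).c₄ : ℚ) = W.c₄ := by
  rw [← baseChange_int_c₄, baseChange_integralModelInt]

/-- `c₆(W) = c₆(W_ℤ)` in `ℚ`. [folklore] -/
theorem cast_integralModelInt_c₆ (W : WeierstrassCurve ℚ) [W.IsGloballyMinimal] :
    ((integralModelInt W).c₆ : ℚ) = W.c₆ := by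
  rw [← baseChange_int_c₆, baseChange_integralModelInt]

/-- `Δ(W) = Δ(W_ℤ)` in `ℚ` (this is `cast_minimalDiscriminantInt`). [folklore] -/
theorem cast_integralModelInt_Δ (W : WeierstrassCurve ℚ) [W.IsGloballyMinimal] :
    ((integralModelInt W).Δ : ℚ) = W.Δ :=
  cast_minimalDiscriminantInt W

/-- **Semistable at `p` ⟹ `p ∤ Δ_min` or `p ∤ c₄`.** For a globally minimal model `W` of an
elliptic curve over `ℚ` with integral model `W_ℤ`, if `W` is semistable at the place `v` of `ℤ`
below the prime `p`, then `p ∤ Δ(W_ℤ)` (good reduction) or `p ∤ c₄(W_ℤ)` (multiplicative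
reduction). Silverman, AEC VII.5, Prop. 5.1 read on the minimal equation `W`
(`isSemistableAt_iff_of_isMinimalAt`), with `v(n) = 1 ↔ p ∤ n` on `ℤ`
(`Literature.NumberTheory.EllipticCurves.Rat.valuation_intCast_eq_one_iff`).
[cite: SilvermanAEC2009, VII.5 Prop. 5.1 (PDF p. 174)] -/
theorem not_dvd_Δ_or_not_dvd_c₄_of_isSemistableAt (W : WeierstrassCurve ℚ) [W.IsElliptic]
    [W.IsGloballyMinimal] {v : HeightOneSpectrum ℤ} (h : W.IsSemistableAt v) :
    ¬ (natGenerator v : ℤ) ∣ (integralModelInt W).Δ ∨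
      ¬ (natGenerator v : ℤ) ∣ (integralModelInt W).c₄ := by
  rw [isSemistableAt_iff_of_isMinimalAt (IsGloballyMinimal.isMinimalAt_int W v),
    ← cast_integralModelInt_Δ, ← cast_integralModelInt_c₄,
    Literature.NumberTheory.EllipticCurves.Rat.valuation_intCast_eq_one_iff,
    Literature.NumberTheory.EllipticCurves.Rat.valuation_intCast_eq_one_iff] at h
  exact h

/-- **`p ∤ Δ` or `p ∤ c₄` ⟹ semistable at `p`**, for any equation `W₀` over `ℤ` of an elliptic
curve: `v(Δ) = 0` gives good reduction, `v(c₄) = 0` gives good or multiplicative reduction (the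
equation is then minimal at `p`, Silverman AEC VII.1, Remark 1.1, and Prop. VII.5.1 applies; the
tree's `isSemistableAt_of_valuation_Δ_eq_one`, `isSemistableAt_of_valuation_c₄_eq_one`).
[cite: SilvermanAEC2009, VII.5 Prop. 5.1(a),(b) (PDF p. 174) and VII.1 Remark 1.1] -/
theorem isSemistableAt_of_not_dvd_Δ_or_not_dvd_c₄ (W₀ : WeierstrassCurve ℤ)
    [(W₀.baseChange ℚ).IsElliptic] {v : HeightOneSpectrum ℤ}
    (h : ¬ (natGenerator v : ℤ) ∣ W₀.Δ ∨ ¬ (natGenerator v : ℤ) ∣ W₀.c₄) :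
    (W₀.baseChange ℚ).IsSemistableAt v := by
  rcases h with hΔ | hc
  · refine isSemistableAt_of_valuation_Δ_eq_one (isIntegralAt_baseChange_int v W₀) ?_
    rw [baseChange_int_Δ, Literature.NumberTheory.EllipticCurves.Rat.valuation_intCast_eq_one_iff]
    exact hΔ
  · refine isSemistableAt_of_valuation_c₄_eq_one (isIntegralAt_baseChange_int v W₀) ?_
    rw [baseChange_int_c₄, Literature.NumberTheory.EllipticCurves.Rat.valuation_intCast_eq_one_iff]
    exact hc

/-- **Semistable ⟹ no prime divides both `c₄(W_ℤ)` and `Δ(W_ℤ)`**, for a globally minimal model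
`W` of a semistable elliptic curve over `ℚ` (`not_dvd_Δ_or_not_dvd_c₄_of_isSemistableAt` at the
place of `ℤ` below `p`). [cite: SilvermanAEC2009, VII.5 Prop. 5.1 (PDF p. 174)] -/
theorem not_dvd_c₄_and_dvd_Δ_of_isSemistable (W : WeierstrassCurve ℚ) [W.IsElliptic]
    [W.IsGloballyMinimal] (h : W.IsSemistable ℤ) {p : ℕ} (hp : p.Prime) :
    ¬ ((p : ℤ) ∣ (integralModelInt W).c₄ ∧ (p : ℤ) ∣ (integralModelInt W).Δ) := by
  have hv := not_dvd_Δ_or_not_dvd_c₄_of_isSemistableAt W (h ((primesEquiv (R := ℤ)).symm ⟨p, hp⟩))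
  rw [Literature.NumberTheory.EllipticCurves.Rat.natGenerator_primesEquiv_symm] at hv
  tauto

/-- `IsCoprime a b` in `ℤ` iff no prime divides both. [folklore] -/
theorem _root_.Literature.NumberTheory.EllipticCurves.Int.isCoprime_iff_forall_prime_not_dvd
    (a b : ℤ) : IsCoprime a b ↔ ∀ p : ℕ, p.Prime → ¬ ((p : ℤ) ∣ a ∧ (p : ℤ) ∣ b) := by
  rw [Int.isCoprime_iff_nat_coprime]
  constructor
  · rintro h p hp ⟨ha, hb⟩
    have hd : p ∣ Nat.gcd a.natAbs b.natAbs :=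
      Nat.dvd_gcd (Int.natCast_dvd.mp ha) (Int.natCast_dvd.mp hb)
    rw [h.gcd_eq_one, Nat.dvd_one] at hd
    exact hp.ne_one hd
  · intro h
    exact Nat.coprime_of_dvd fun p hp ha hb ↦
      h p hp ⟨Int.natCast_dvd.mpr ha, Int.natCast_dvd.mpr hb⟩

/-- **Semistability criterion.** A globally minimal model `W` of an elliptic curve over `ℚ` is
semistable iff `gcd(c₄(W_ℤ), Δ(W_ℤ)) = 1` for its integral model `W_ℤ`: a prime of additive
reduction is exactly a common prime divisor of `c₄` and `Δ` of a minimal equation (Silverman,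
AEC VII.5, Prop. 5.1(c)). [cite: SilvermanAEC2009, VII.5 Prop. 5.1 (PDF p. 174)] -/
theorem isSemistable_iff_isCoprime_c₄_Δ (W : WeierstrassCurve ℚ) [W.IsElliptic]
    [W.IsGloballyMinimal] :
    W.IsSemistable ℤ ↔ IsCoprime (integralModelInt W).c₄ (integralModelInt W).Δ := by
  rw [Literature.NumberTheory.EllipticCurves.Int.isCoprime_iff_forall_prime_not_dvd]
  refine ⟨fun h p hp ↦ not_dvd_c₄_and_dvd_Δ_of_isSemistable W h hp, fun h v ↦ ?_⟩
  haveI : ((integralModelInt W).baseChange ℚ).IsElliptic := by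
    rw [baseChange_integralModelInt]; infer_instance
  have key : ((integralModelInt W).baseChange ℚ).IsSemistableAt v := by
    refine isSemistableAt_of_not_dvd_Δ_or_not_dvd_c₄ (integralModelInt W) ?_
    have := h (natGenerator v) (prime_natGenerator v)
    tauto
  rwa [baseChange_integralModelInt] at key

end WeierstrassCurve

/-! ### `|c| = 1` versus coprimality: the integer bookkeeping -/

namespace Literature.NumberTheory.EllipticCurves.ModularForms

/-- **`|c| = 1` iff `c⁴ a` and `c¹² b` stay coprime**, for coprime integers `a`, `b`: a prime
factor of `c` divides both, and `|c| = 1` makes the powers `1`. (With `a = c₄(W_ℤ)`,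
`b = Δ(W_ℤ)`: `c⁴ a`, `c¹² b` are `c₄` and `Δ` of the rescaled integral model `(1/c) • W_ℤ`.)
[folklore] -/
theorem Int.abs_eq_one_iff_isCoprime_pow_mul {a b : ℤ} (hab : IsCoprime a b) (c : ℤ) :
    |c| = 1 ↔ IsCoprime (c ^ 4 * a) (c ^ 12 * b) := by
  constructor
  · intro h
    have h2 : c ^ 2 = 1 := by rw [← sq_abs, h, one_pow]
    have h4 : c ^ 4 = 1 := by rw [show (4 : ℕ) = 2 * 2 by norm_num, pow_mul, h2, one_pow]
    have h12 : c ^ 12 = 1 := by rw [show (12 : ℕ) = 2 * 6 by norm_num, pow_mul, h2, one_pow]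
    rwa [h4, h12, one_mul, one_mul]
  · intro h
    have h' : IsCoprime (c ^ 4) (c ^ 12) := h.of_mul_left_left.of_mul_right_left
    rw [IsCoprime.pow_left_iff (by norm_num), IsCoprime.pow_right_iff (by norm_num),
      isCoprime_self] at h'
    exact Int.isUnit_iff_abs_eq.mp h'

/-- **`p ∤ c` iff `p` does not divide both `c⁴ a` and `c¹² b`**, for integers `a`, `b` not both
divisible by the prime `p` (the prime-by-prime form of
`Int.abs_eq_one_iff_isCoprime_pow_mul`). [folklore] -/
theorem Int.not_dvd_iff_not_dvd_pow_mul {a b : ℤ} {p : ℕ} (hp : p.Prime)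
    (hab : ¬ ((p : ℤ) ∣ a ∧ (p : ℤ) ∣ b)) (c : ℤ) :
    ¬ (p : ℤ) ∣ c ↔ ¬ ((p : ℤ) ∣ c ^ 4 * a ∧ (p : ℤ) ∣ c ^ 12 * b) := by
  have hp' : Prime (p : ℤ) := Nat.prime_iff_prime_int.mp hp
  constructor
  · rintro hc ⟨ha, hb⟩
    exact hab ⟨(hp'.dvd_or_dvd ha).resolve_left fun h ↦ hc (hp'.dvd_of_dvd_pow h),
      (hp'.dvd_or_dvd hb).resolve_left fun h ↦ hc (hp'.dvd_of_dvd_pow h)⟩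
  · intro h hc
    exact h ⟨dvd_mul_of_dvd_left (dvd_pow hc (by norm_num)) _,
      dvd_mul_of_dvd_left (dvd_pow hc (by norm_num)) _⟩

/-! ### `|c| = 1` as a coprimality, for a semistable curve -/

/-- **For a globally minimal model `W` of a semistable elliptic curve over `ℚ` and any integer
`c`: `|c| = 1 ↔ gcd(c⁴ c₄(W_ℤ), c¹² Δ(W_ℤ)) = 1`** (`gcd(c₄(W_ℤ), Δ(W_ℤ)) = 1` by the
semistability criterion `WeierstrassCurve.isSemistable_iff_isCoprime_c₄_Δ`, Silverman AEC
VII.5.1). For the Manin constant `c` of an optimal parametrisation the two integers are the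
invariants `c₄(Λ_f) = 12 g₂(Λ_f)` and `Δ(Λ_f)` of the period lattice of the newform
(`IsNeronLatticeOf.twelve_mul_g₂_eq_intCast`, `IsNeronLatticeOf.discr_eq_intCast`).
[cite: SilvermanAEC2009, VII.5 Prop. 5.1 (PDF p. 174)] -/
theorem abs_eq_one_iff_isCoprime_of_isSemistable (W : WeierstrassCurve ℚ) [W.IsElliptic]
    [W.IsGloballyMinimal] (hss : W.IsSemistable ℤ) (c : ℤ) :
    |c| = 1 ↔ IsCoprime (c ^ 4 * (WeierstrassCurve.integralModelInt W).c₄)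
      (c ^ 12 * (WeierstrassCurve.integralModelInt W).Δ) :=
  Int.abs_eq_one_iff_isCoprime_pow_mul ((W.isSemistable_iff_isCoprime_c₄_Δ).mp hss) c

/-- **Prime by prime: `p ∤ c ↔ ¬ (p ∣ c⁴ c₄(W_ℤ) ∧ p ∣ c¹² Δ(W_ℤ))`** as soon as the globally
minimal `W` is semistable *at `p`* (`p ∤ Δ(W_ℤ)` or `p ∤ c₄(W_ℤ)`,
`WeierstrassCurve.not_dvd_Δ_or_not_dvd_c₄_of_isSemistableAt`) — the hypothesis `p² ∤ n` of
Česnavičius 2018, Thm. 1.2, whose conclusion is `ord_p(c_π) = 0`.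
[cite: SilvermanAEC2009, VII.5 Prop. 5.1 (PDF p. 174)] -/
theorem not_dvd_iff_of_isSemistableAt (W : WeierstrassCurve ℚ) [W.IsElliptic]
    [W.IsGloballyMinimal] {p : ℕ} (hp : p.Prime)
    (hss : W.IsSemistableAt ((primesEquiv (R := ℤ)).symm ⟨p, hp⟩)) (c : ℤ) :
    ¬ (p : ℤ) ∣ c ↔ ¬ ((p : ℤ) ∣ c ^ 4 * (WeierstrassCurve.integralModelInt W).c₄ ∧
      (p : ℤ) ∣ c ^ 12 * (WeierstrassCurve.integralModelInt W).Δ) := by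
  refine Int.not_dvd_iff_not_dvd_pow_mul hp ?_ c
  have hv := W.not_dvd_Δ_or_not_dvd_c₄_of_isSemistableAt hss
  rw [Literature.NumberTheory.EllipticCurves.Rat.natGenerator_primesEquiv_symm] at hv
  tauto

/-! ### The invariants of `Λ_f` are the integers `c⁴ c₄(W_ℤ)`, `c⁶ c₆(W_ℤ)`, `c¹² Δ(W_ℤ)` -/

section LatticeInvariants

variable {W : WeierstrassCurve ℚ} [W.IsGloballyMinimal] {L L' : PeriodPair}

/-- **`c₄(Λ') = c⁴ c₄(W_ℤ)`, `c₆(Λ') = c⁶ c₆(W_ℤ)`.** If `L` is a Néron-type period pair of a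
globally minimal `W/ℚ` with integral model `W_ℤ` and `Λ_L = c Λ'` for an integer `c ≠ 0` and a
period pair `L'`, then the lattice invariants `c₄(Λ') := 12 g₂(Λ')`, `c₆(Λ') := 216 g₃(Λ')`
(Cremona 1997, §2.14, (2.14.1): "the lattice invariants `c₄ (= 12g₂)` and `c₆ (= 216g₃)`") are
the integers `c⁴ c₄(W_ℤ)` and `c⁶ c₆(W_ℤ)` — the invariants of the integral model `(1/c) • W_ℤ`
(`IsNeronLatticeOf.c₄_eq_of_lattice_eq_mulLeft`: `c₄(W) = 12 c⁻⁴ g₂(Λ')`,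
`c₆(W) = 216 c⁻⁶ g₃(Λ')`). With `Λ' = Λ_f` and `c` the Manin constant these are the numbers that
Cremona's tables compare with the invariants of the minimal model.
[cite: CremonaAlgorithms1997, §2.14 (2.14.1), pp. 33–34] -/
theorem IsNeronLatticeOf.twelve_mul_g₂_eq_intCast (hL : IsNeronLatticeOf (W.baseChange ℂ) L)
    {c : ℤ} (hc : (c : ℂ) ≠ 0) (hΛ : L.lattice = (L'.mulLeft (c : ℂ) hc).lattice) :
    12 * L'.g₂ = ((c ^ 4 * (WeierstrassCurve.integralModelInt W).c₄ : ℤ) : ℂ) ∧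
      216 * L'.g₃ = ((c ^ 6 * (WeierstrassCurve.integralModelInt W).c₆ : ℤ) : ℂ) := by
  obtain ⟨h₄, h₆⟩ := hL.c₄_eq_of_lattice_eq_mulLeft hc hΛ
  have e₄ : ((WeierstrassCurve.integralModelInt W).c₄ : ℂ) = (W.c₄ : ℂ) := by
    rw [← WeierstrassCurve.cast_integralModelInt_c₄ W, Rat.cast_intCast]
  have e₆ : ((WeierstrassCurve.integralModelInt W).c₆ : ℂ) = (W.c₆ : ℂ) := by
    rw [← WeierstrassCurve.cast_integralModelInt_c₆ W, Rat.cast_intCast]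
  have h4 : (c : ℂ) ^ 4 ≠ 0 := pow_ne_zero _ hc
  have h6 : (c : ℂ) ^ 6 ≠ 0 := pow_ne_zero _ hc
  push_cast
  rw [e₄, e₆, h₄, h₆]
  constructor
  · field_simp
  · field_simp

/-- **`Δ(Λ') = c¹² Δ(W_ℤ)`** in the situation of `IsNeronLatticeOf.twelve_mul_g₂_eq_intCast`:
the discriminant `g₂(Λ')³ − 27 g₃(Λ')²` of the period lattice is the integer `c¹² Δ_min(E)`
(`IsNeronLatticeOf.Δ_eq_of_lattice_eq_mulLeft`: `Δ(W) = c⁻¹² Δ(Λ')`, and `Δ(W) = Δ(W_ℤ)` is the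
minimal discriminant, `WeierstrassCurve.cast_minimalDiscriminantInt`).
[cite: SilvermanAEC2009, III.1 (PDF p. 50), 1728Δ = c₄³ - c₆²] -/
theorem IsNeronLatticeOf.discr_eq_intCast (hL : IsNeronLatticeOf (W.baseChange ℂ) L)
    {c : ℤ} (hc : (c : ℂ) ≠ 0) (hΛ : L.lattice = (L'.mulLeft (c : ℂ) hc).lattice) :
    L'.g₂ ^ 3 - 27 * L'.g₃ ^ 2 = ((c ^ 12 * (WeierstrassCurve.integralModelInt W).Δ : ℤ) : ℂ) := by
  have hΔ := hL.Δ_eq_of_lattice_eq_mulLeft hc hΛ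
  have eΔ : ((WeierstrassCurve.integralModelInt W).Δ : ℂ) = (W.Δ : ℂ) := by
    rw [← WeierstrassCurve.cast_integralModelInt_Δ W, Rat.cast_intCast]
  have h12 : (c : ℂ) ^ 12 ≠ 0 := pow_ne_zero _ hc
  push_cast
  rw [eΔ, hΔ]
  field_simp

/-- **Integrality of the lattice invariants.** In the situation of
`IsNeronLatticeOf.twelve_mul_g₂_eq_intCast` (`Λ_L = c Λ'`, `c ∈ ℤ ∖ {0}`, `L` a Néron-type
period pair of a globally minimal `W/ℚ`), `12 g₂(Λ')`, `216 g₃(Λ')` and `g₂(Λ')³ − 27 g₃(Λ')²`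
are rational integers. For `Λ' = Λ_f` and `c` the Manin constant of the optimal parametrisation
(an integer: Edixhoven 1991, Prop. 2) this is the integrality of `c₄(Λ_f)`, `c₆(Λ_f)` used in
Cremona 1997, §2.14. [cite: CremonaAlgorithms1997, §2.14, pp. 33–34] -/
theorem IsNeronLatticeOf.exists_intCast_eq_invariants (hL : IsNeronLatticeOf (W.baseChange ℂ) L)
    {c : ℤ} (hc : (c : ℂ) ≠ 0) (hΛ : L.lattice = (L'.mulLeft (c : ℂ) hc).lattice) :
    ∃ m n d : ℤ, (m : ℂ) = 12 * L'.g₂ ∧ (n : ℂ) = 216 * L'.g₃ ∧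
      (d : ℂ) = L'.g₂ ^ 3 - 27 * L'.g₃ ^ 2 :=
  ⟨_, _, _, (hL.twelve_mul_g₂_eq_intCast hc hΛ).1.symm, (hL.twelve_mul_g₂_eq_intCast hc hΛ).2.symm,
    (hL.discr_eq_intCast hc hΛ).symm⟩

/-- **`|c| = 1` iff `c₄(Λ')` and `Δ(Λ')` are coprime.** Let `W/ℚ` be a globally minimal model of a
*semistable* elliptic curve, `L` a Néron-type period pair of `W`, and `Λ_L = c Λ'` for an integer
`c` and a period pair `L'`. Then `|c| = 1` iff any (equivalently: the) integers `m = 12 g₂(Λ')`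
and `d = g₂(Λ')³ − 27 g₃(Λ')²` are coprime: `m = c⁴ c₄(W_ℤ)`, `d = c¹² Δ(W_ℤ)` with
`gcd(c₄(W_ℤ), Δ(W_ℤ)) = 1` (semistable and minimal, Silverman AEC VII.5.1). Equivalently: the
integral model of `E` with invariants `c₄(Λ')`, `c₆(Λ')` — whose invariant differential has
period lattice exactly `Λ'` — is a global minimal model. With `Λ' = Λ_f`: the Manin constant of a
semistable optimal curve is `±1` iff `gcd(c₄(Λ_f), Δ(Λ_f)) = 1`.
[cite: CremonaAlgorithms1997, §2.14, pp. 33–34] -/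
theorem IsNeronLatticeOf.abs_eq_one_iff_forall_intCast_isCoprime [W.IsElliptic]
    (hss : W.IsSemistable ℤ) (hL : IsNeronLatticeOf (W.baseChange ℂ) L)
    {c : ℤ} (hc : (c : ℂ) ≠ 0) (hΛ : L.lattice = (L'.mulLeft (c : ℂ) hc).lattice) :
    |c| = 1 ↔ ∀ m d : ℤ, (m : ℂ) = 12 * L'.g₂ → (d : ℂ) = L'.g₂ ^ 3 - 27 * L'.g₃ ^ 2 →
      IsCoprime m d := by
  have hm := (hL.twelve_mul_g₂_eq_intCast hc hΛ).1
  have hd := hL.discr_eq_intCast hc hΛ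
  rw [abs_eq_one_iff_isCoprime_of_isSemistable W hss c]
  constructor
  · intro h m d hm' hd'
    have em : m = c ^ 4 * (WeierstrassCurve.integralModelInt W).c₄ :=
      Int.cast_injective (α := ℂ) (hm'.trans hm)
    have ed : d = c ^ 12 * (WeierstrassCurve.integralModelInt W).Δ :=
      Int.cast_injective (α := ℂ) (hd'.trans hd)
    rw [em, ed]
    exact h
  · intro h
    exact h _ _ hm.symm hd.symm

/-- **Prime by prime: `p ∤ c` iff `p ∤ gcd(c₄(Λ'), Δ(Λ'))`.** In the situation of
`IsNeronLatticeOf.abs_eq_one_iff_forall_intCast_isCoprime`, but assuming only that the globally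
minimal `W` is semistable *at `p`*: `p ∤ c` iff no integers `m = 12 g₂(Λ')`,
`d = g₂(Λ')³ − 27 g₃(Λ')²` are both divisible by `p`. With `Λ' = Λ_f` and `c = ±c_π` this is the
dictionary for Česnavičius 2018, Thm. 1.2 (`p² ∤ n ⟹ ord_p(c_π) = 0`): the `p`-part of the Manin
conjecture says that the `f`-model of `E` is minimal at `p`.
[cite: Cesnavicius2018, Thm. 1.2] -/
theorem IsNeronLatticeOf.not_dvd_iff_forall_intCast [W.IsElliptic] {p : ℕ} (hp : p.Prime)
    (hss : W.IsSemistableAt ((primesEquiv (R := ℤ)).symm ⟨p, hp⟩))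
    (hL : IsNeronLatticeOf (W.baseChange ℂ) L)
    {c : ℤ} (hc : (c : ℂ) ≠ 0) (hΛ : L.lattice = (L'.mulLeft (c : ℂ) hc).lattice) :
    ¬ (p : ℤ) ∣ c ↔ ∀ m d : ℤ, (m : ℂ) = 12 * L'.g₂ → (d : ℂ) = L'.g₂ ^ 3 - 27 * L'.g₃ ^ 2 →
      ¬ ((p : ℤ) ∣ m ∧ (p : ℤ) ∣ d) := by
  have hm := (hL.twelve_mul_g₂_eq_intCast hc hΛ).1
  have hd := hL.discr_eq_intCast hc hΛ
  rw [not_dvd_iff_of_isSemistableAt W hp hss c]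
  constructor
  · intro h m d hm' hd'
    have em : m = c ^ 4 * (WeierstrassCurve.integralModelInt W).c₄ :=
      Int.cast_injective (α := ℂ) (hm'.trans hm)
    have ed : d = c ^ 12 * (WeierstrassCurve.integralModelInt W).Δ :=
      Int.cast_injective (α := ℂ) (hd'.trans hd)
    rw [em, ed]
    exact h
  · intro h
    exact h _ _ hm.symm hd.symm

end LatticeInvariants

/-! ### The coprime-invariants form of the open content -/

namespace ModularParametrizationData

/-- **The open content of `abs_maninConstant_eq_one_of_isSemistable`, coprime-invariants form.**
The universal closure of the vendored fact is equivalent to: *for a globally minimal model `W` of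
a semistable elliptic curve over `ℚ`, its newform `f`, a period pair `L_f` spanning `Λ_f`, a
Néron-type period pair `L` of `W` and an integer `c` with `Λ_L = c Λ_f`, any integers
`m = 12 g₂(Λ_f)` and `d = g₂(Λ_f)³ − 27 g₃(Λ_f)²` are coprime* — the conclusion mentions only
the period lattice of `f`: its invariants `c₄(Λ_f)`, `Δ(Λ_f)` (integers,
`IsNeronLatticeOf.exists_intCast_eq_invariants`) are those of a global minimal model with
semistable reduction, i.e. the `f`-model `(1/c) • W_ℤ` of `E` is minimal. This is the statement
verified in Cremona's computations (1997, §2.14, pp. 33–34; all `n ≤ 390000` by 2018,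
Česnavičius 2018, §1) and, for semistable `E`, Česnavičius's theorem (2018, Thm. 1.2). Proof:
`forall_abs_maninConstant_eq_one_of_isSemistable_iff_invariantsForm` with
`IsNeronLatticeOf.abs_eq_one_iff_c₄_eq_c₆_eq` and
`IsNeronLatticeOf.abs_eq_one_iff_forall_intCast_isCoprime`.
[cite: Cesnavicius2018, Thm. 1.2] [cite: CremonaAlgorithms1997, §2.14, pp. 33–34] -/
theorem forall_abs_maninConstant_eq_one_of_isSemistable_iff_coprimeForm :
    (∀ {W' : WeierstrassCurve ℚ} {N' : ℕ} [NeZero N'] (D' : ModularParametrizationData W' N'),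
      D'.abs_maninConstant_eq_one_of_isSemistable) ↔
    ∀ (W' : WeierstrassCurve ℚ) [W'.IsElliptic] [W'.IsGloballyMinimal], W'.IsSemistable ℤ →
      ∀ {N' : ℕ} [NeZero N'] {f : CuspForm (CongruenceSubgroup.Gamma0 N') 2}, IsNewformOf W' f →
      ∀ {Lf : PeriodPair}, Lf.lattice.toAddSubgroup = periodLattice f →
      ∀ {L : PeriodPair}, IsNeronLatticeOf (W'.baseChange ℂ) L →
      ∀ (c : ℤ) (hc : (c : ℂ) ≠ 0), L.lattice = (Lf.mulLeft (c : ℂ) hc).lattice →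
        ∀ m d : ℤ, (m : ℂ) = 12 * Lf.g₂ → (d : ℂ) = Lf.g₂ ^ 3 - 27 * Lf.g₃ ^ 2 →
          IsCoprime m d := by
  rw [forall_abs_maninConstant_eq_one_of_isSemistable_iff_invariantsForm]
  constructor
  · intro h W' _ _ hss N' _ f hf Lf hLf L hL c hc hΛ
    exact (hL.abs_eq_one_iff_forall_intCast_isCoprime hss hc hΛ).mp
      ((hL.abs_eq_one_iff_c₄_eq_c₆_eq hc hΛ).mpr (h W' hss hf hLf hL c hc hΛ))
  · intro h W' _ _ hss N' _ f hf Lf hLf L hL c hc hΛ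
    exact (hL.abs_eq_one_iff_c₄_eq_c₆_eq hc hΛ).mp
      ((hL.abs_eq_one_iff_forall_intCast_isCoprime hss hc hΛ).mpr (h W' hss hf hLf hL c hc hΛ))

variable {W : WeierstrassCurve ℚ} {N : ℕ} [NeZero N] (D : ModularParametrizationData W N)

/-- **Datum by datum.** For *any* modular parametrisation datum `D` of a globally minimal model
`W` of a semistable elliptic curve over `ℚ`, with Manin constant `c` and integral model `W_ℤ`:
`|c| = 1 ↔ gcd(c⁴ c₄(W_ℤ), c¹² Δ(W_ℤ)) = 1` (`abs_eq_one_iff_isCoprime_of_isSemistable`); for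
`D` of minimal degree the two integers are `c₄(Λ_f)` and `Δ(Λ_f)`
(`lattice_invariants_eq_of_modularDegree_le`). [cite: SilvermanAEC2009, VII.5 Prop. 5.1 (PDF p. 174)] -/
theorem abs_maninConstant_eq_one_iff_isCoprime [W.IsElliptic] [W.IsGloballyMinimal]
    (hss : W.IsSemistable ℤ) :
    |D.maninConstant| = 1 ↔ IsCoprime (D.maninConstant ^ 4 * (WeierstrassCurve.integralModelInt W).c₄)
      (D.maninConstant ^ 12 * (WeierstrassCurve.integralModelInt W).Δ) :=
  abs_eq_one_iff_isCoprime_of_isSemistable W hss _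

/-- **The vendored fact, datum by datum, as a coprimality.** For every datum `D`,
`D.abs_maninConstant_eq_one_of_isSemistable` is equivalent to the same implication with the
conclusion `|c| = 1` replaced by `IsCoprime (c⁴ c₄(W_ℤ)) (c¹² Δ(W_ℤ))` — for `D` of minimal
degree, `gcd(c₄(Λ_f), Δ(Λ_f)) = 1`. [cite: Cesnavicius2018, Thm. 1.2] -/
theorem abs_maninConstant_eq_one_of_isSemistable_iff_isCoprime :
    D.abs_maninConstant_eq_one_of_isSemistable ↔
      ∀ [W.IsElliptic] [W.IsGloballyMinimal], W.IsSemistable ℤ →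
        (∀ (W' : WeierstrassCurve ℚ) [W'.IsElliptic] (D' : ModularParametrizationData W' N),
          D'.f = D.f → D.modularDegree ≤ D'.modularDegree) →
        IsCoprime (D.maninConstant ^ 4 * (WeierstrassCurve.integralModelInt W).c₄)
          (D.maninConstant ^ 12 * (WeierstrassCurve.integralModelInt W).Δ) := by
  constructor
  · intro h _ _ hss hmin
    exact (D.abs_maninConstant_eq_one_iff_isCoprime hss).mp (h hss hmin)
  · intro h _ _ hss hmin
    exact (D.abs_maninConstant_eq_one_iff_isCoprime hss).mpr (h hss hmin)

/-- **For a datum of minimal degree, the invariants of `Λ_f` are `c⁴ c₄(W_ℤ)`, `c⁶ c₆(W_ℤ)`,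
`c¹² Δ(W_ℤ)`.** If `W/ℚ` is globally minimal and `D` has minimal degree among all data with the
same newform (so `Λ_E = c Λ_f`: an optimal datum exists, `exists_optimalDatum'`, and
`latticeEq_of_modularDegree_le`, Knapp 1993, Prop. 12.9), then for every period pair `L_f`
spanning `Λ_f`: `12 g₂(Λ_f) = c⁴ c₄(W_ℤ)`, `216 g₃(Λ_f) = c⁶ c₆(W_ℤ)`,
`g₂(Λ_f)³ − 27 g₃(Λ_f)² = c¹² Δ(W_ℤ)` with `c` the Manin constant — Cremona's
"`c₄ (= 12g₂)`, `c₆ (= 216g₃)`" of `Λ_f` versus the invariants of the minimal model (1997, §2.14).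
[cite: CremonaAlgorithms1997, §2.14 (2.14.1), pp. 33–34] -/
theorem lattice_invariants_eq_of_modularDegree_le [W.IsElliptic] [W.IsGloballyMinimal]
    (hmin : ∀ (W' : WeierstrassCurve ℚ) [W'.IsElliptic] (D' : ModularParametrizationData W' N),
      D'.f = D.f → D.modularDegree ≤ D'.modularDegree)
    {Lf : PeriodPair} (hLf : Lf.lattice.toAddSubgroup = periodLattice D.f) :
    12 * Lf.g₂ = ((D.maninConstant ^ 4 * (WeierstrassCurve.integralModelInt W).c₄ : ℤ) : ℂ) ∧
      216 * Lf.g₃ = ((D.maninConstant ^ 6 * (WeierstrassCurve.integralModelInt W).c₆ : ℤ) : ℂ) ∧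
      Lf.g₂ ^ 3 - 27 * Lf.g₃ ^ 2 =
        ((D.maninConstant ^ 12 * (WeierstrassCurve.integralModelInt W).Δ : ℤ) : ℂ) := by
  obtain ⟨W₀, hW₀, D₀, hf₀, h₀⟩ := D.exists_optimalDatum'
  haveI := hW₀
  have hge := D.latticeEq_of_modularDegree_le D₀ hf₀ h₀ (hmin W₀ D₀ hf₀)
  have hΛ : D.L.lattice = (Lf.mulLeft (D.c : ℂ) D.cast_c_ne_zero).lattice :=
    (lattice_eq_mulLeft_iff_of_eq_periodLattice hLf D.L D.cast_c_ne_zero).mpr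
      ⟨D.smul_periodLattice_le, hge⟩
  exact ⟨(D.isNeronLattice.twelve_mul_g₂_eq_intCast _ hΛ).1,
    (D.isNeronLattice.twelve_mul_g₂_eq_intCast _ hΛ).2, D.isNeronLattice.discr_eq_intCast _ hΛ⟩

end ModularParametrizationData

end Literature.NumberTheory.EllipticCurves.ModularForms

end
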